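import Literature.AlgebraicGeometry.Resolution.FrobeniusSandwich
import Literature.AlgebraicGeometry.Resolution.AlterationsResolution
import Summits.ResolutionOfSingularities.ResolutionOfSingularities.Statement
import HarnessLib
import HarnessLib.Audit.Tags

/-!
# Resolution of singularities: the Frobenius-sandwich normal form (solo-blind line)

For a prime `p`, resolution of singularities of reduced separated schemes of finite type over
fields of characteristic `p` (`ResolutionInChar p`, summit `ResolutionOfSingularities`) splits into
two statements of different nature, each open exactly where the summit is open (dimension `≥ 4`):

* **(AO) regular purely inseparable alterations** — the Abramovich–Oort conjecture
  `AbramovichOortConjecture` of `Literature/…/Alterations.lean` (Abramovich–Oort 2000, Question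
  2.13; Temkin 2013, Conj. 1.3.1): every variety `X` receives a proper surjective `π : Y → X`
  from a REGULAR variety `Y` with `k(Y)/k(X)` finite purely inseparable. This is implied by
  resolution (`abramovichOort_of_resolutionInChar`, in tree) and its local form along any
  valuation is a theorem (Temkin 2013, Thm. 1.3.2).
* **(F1) resolution of Frobenius sandwiches** — `SoloBlind.FrobeniusSandwichResolution`: every
  variety `Z` which is the target of a finite surjective height-one purely inseparable morphism
  `f : Y → Z` (`𝒪_Y^p ⊆ 𝒪_Z`) from a REGULAR variety `Y` — i.e. `Z = Y/𝓕` for a `1`-foliation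
  `𝓕 ⊆ T_Y` — admits a resolution. Trivially implied by resolution; known for `dim ≤ 3`
  (Cossart–Piltant), and — independently of Cossart–Piltant's theorem — for `dim ≤ 3`, `p > 2`,
  `k` algebraically closed, from resolution of `1`-foliations by regular tame Deligne–Mumford
  stacks (Posva, arXiv:2405.05735, Thm. 2 with Prop. 3.3.1) followed by destackification
  (Bergh–Rydh).

**Theorem A (this file, `SoloBlind.SandwichReduction_holds`).** `(AO) ∧ (F1) ⟹` resolution of
singularities, for all `p` at once, modulo four elementary scheme-theoretic lemmas recorded as
named obligation nodes (`SoloBlind.ExponentStep`, `.QuotientStep`, `.ResolveStep`, `.BaseStep`,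
`.ComponentStep`; paper proofs in the solo-blind notes `paper/reduction.md`, not yet formalised):
given a regular purely inseparable alteration `π : Y → X` of exponent `p^e`, factor off ONE
Frobenius layer `Y → Z := (|Y|, 𝒪_Y ∩ k(X)·k(Y)^p) → X` (relative Frobenius; `Z` is again a
variety, `Y → Z` is a Frobenius sandwich, `Z → X` has exponent `p^(e-1)`), resolve `Z` by (F1),
compose (a resolution of the source of a purely inseparable alteration of exponent `q` gives one
of exponent `q`), and induct on `e`; at `e = 0` the alteration is an isomorphism over a dense
open, i.e. a resolution (`SoloBlind.hasResolution_of_alterationOfExponent`). Reduced schemes are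
handled component by component. Converse bookkeeping: resolution implies (F1)
(`SoloBlind.frobeniusSandwichResolution_of_forall_resolutionInChar`) and (AO) (in tree).

So the gap between "resolution up to purely inseparable alteration" (asked for by
Abramovich–Oort, Question 2.13) and resolution itself is exactly the resolution of height-ONE
Frobenius quotients of regular varieties — a problem about singularities of `1`-foliations
(`p`-closed distributions) on regular varieties, cf. Posva's programme in dimension `≤ 3`.

References: [cite: Temkin2013, Conj. 1.3.1 and Thm. 1.3.2, pp. 3–4]
[cite: AbramovichOort2000, Question 2.13, p. 9] [cite: Posva2024, Thm. 2 p. 3, Prop. 3.3.1, Rem. 5.2.2]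
[cite: BerghRydh2019, Thm. 5 (destackification of tame stacks)] [cite: Ekedahl1987, §1–2]
[cite: Temkin2017, Thm. 1.2.5 (char(X)-alterations: degree a p-power, not purely inseparable)]
-/

noncomputable section

open CategoryTheory AlgebraicGeometry TopologicalSpace
open Literature.AlgebraicGeometry.Resolution

namespace Summit.ResolutionOfSingularities.ResolutionOfSingularities.Theorems

universe u

/-! ## The crux: resolution of Frobenius sandwiches -/

/-- CONJECTURE (crux **F1**, posed here; open in dimension `≥ 4`) — **resolution of Frobenius
sandwiches.** For every prime `p`, field `k` of characteristic `p` and integral separated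
`k`-scheme `Z` of finite type which is a Frobenius sandwich (`IsFrobeniusSandwich p Z`: there is
a finite surjective `f : Y → Z`, purely inseparable of exponent `p` on sections, with `Y` regular
and integral — i.e. `Z = Y/𝓕` for a `1`-foliation on `Y`), `Z` admits a resolution of
singularities. Implied by `ResolutionInChar p`
(`SoloBlind.frobeniusSandwichResolution_of_forall_resolutionInChar`); known in dimension `≤ 3`.
[cite: Posva2024, Thm. 2 p. 3 and Rem. 5.2.2 p. 30 (dimension ≤ 3, p > 2, k = k̄: resolution of
1-foliations by regular tame DM stacks; the statement here is posed by this file, not in print)] -/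
@[conjecture] def SoloBlind.FrobeniusSandwichResolution : Prop :=
  ∀ (p : ℕ) (k : Type u) [Field k] [CharP k p] (Z : Scheme.{u}) (g : Z ⟶ Spec (.of k)),
    p.Prime → IsSeparated g → LocallyOfFiniteType g → QuasiCompact g → IsIntegral Z →
      IsFrobeniusSandwich p Z → Scheme.HasResolution Z

/-! ## The four (plus one) elementary lemmas of the tower, as named obligation nodes

Each is a statement of elementary scheme theory over a field (relative Frobenius, finiteness of
integral closures for varieties, Chevalley, properness bookkeeping); they are recorded as
obligation nodes because their Mathlib formalisation (normalisation, function-field degrees,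
irreducible components as closed subschemes) is not yet available. Paper proofs: solo-blind
`paper/reduction.md`, Lemmas E, Q, R, B, C. -/

/-- LEMMA NODE **E** (exponent extraction; elementary, not yet formalised). A purely inseparable
alteration `π : Y → X` of an integral separated `k`-scheme of finite type, `char k = p` prime, is
a purely inseparable alteration of exponent `p ^ e` on sections for some `e`: `k(Y)/k(X)` is
finitely generated purely inseparable, hence of finite exponent `p^e`; over the (dense, open)
normal locus of `X` intersected with the open of finiteness, `𝒪_Y^{p^e}` is integral over the
normal sheaf `𝒪_X` inside `k(X)`, hence lies in `𝒪_X`. [cite: Temkin2013, §1.3 p. 3 (setting);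
the lemma is folklore commutative algebra, posed here as an obligation] -/
@[conjecture] def SoloBlind.ExponentStep : Prop :=
  ∀ (p : ℕ) (k : Type u) [Field k] [CharP k p] (X Y : Scheme.{u}) (g : X ⟶ Spec (.of k))
    (π : Y ⟶ X), p.Prime → IsSeparated g → LocallyOfFiniteType g → QuasiCompact g →
      IsIntegral X → IsPurelyInseparableAlteration π →
        ∃ e : ℕ, IsPurelyInseparableAlterationOfExponent (p ^ e) π

/-- LEMMA NODE **Q** (quotient step = one layer of relative Frobenius; not yet formalised). Let
`X` be an integral separated `k`-scheme of finite type, `char k = p` prime, and `π : Y → X` a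
purely inseparable alteration of exponent `p^(e+1)` with `Y` regular and integral. Put
`Z := (|Y|, 𝒪_Y ∩ k(X)·k(Y)^p)` (the image of `Y` in its relative Frobenius twist over the
normalisation of `X` in `k(X)·k(Y)^p`). Then `Z` is an integral separated `k`-scheme of finite
type, `f : Y → Z` is finite, surjective and of exponent `p` (so `Z` is a Frobenius sandwich), and
`ρ : Z → X` is a purely inseparable alteration of exponent `p^e` (over the normal locus of `X`
intersected with the open of finiteness of `π`). Finiteness of `f`: `𝒪_Z ⊇ k[𝒪_Y^p]`, over which
`𝒪_Y` is finite (finite type + integral). [cite: Ekedahl1987, §1 (height-one factorisation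
X → X/𝓕 → X^{(1)}); posed here as an obligation] -/
@[conjecture] def SoloBlind.QuotientStep : Prop :=
  ∀ (p : ℕ) (k : Type u) [Field k] [CharP k p] (X Y : Scheme.{u}) (g : X ⟶ Spec (.of k))
    (π : Y ⟶ X) (e : ℕ), p.Prime → IsSeparated g → LocallyOfFiniteType g → QuasiCompact g →
      IsIntegral X → IsIntegral Y → Scheme.IsRegular Y →
        IsPurelyInseparableAlterationOfExponent (p ^ (e + 1)) π →
          ∃ (Z : Scheme.{u}) (f : Y ⟶ Z) (ρ : Z ⟶ X), f ≫ ρ = π ∧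
            IsSeparated (ρ ≫ g) ∧ LocallyOfFiniteType (ρ ≫ g) ∧ QuasiCompact (ρ ≫ g) ∧
            IsIntegral Z ∧ IsFinite f ∧ Surjective f ∧ IsPurelyInseparableOfExponent p f ∧
            IsPurelyInseparableAlterationOfExponent (p ^ e) ρ

/-- LEMMA NODE **R** (resolve-and-compose; not yet formalised). If `ρ : Z → X` is a purely
inseparable alteration of exponent `q` between integral schemes and `σ : Z' → Z` is a resolution
of `Z` (proper, birational, `Z'` regular), then `Z'` is integral and `σ ≫ ρ` is a purely
inseparable alteration of exponent `q`: shrink the dense open `U` of `ρ` to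
`U ∖ ρ(Z ∖ U_σ)`, which is open (`ρ` proper) and non-empty (the fibre of `ρ` over the generic
point is the generic point of `Z`, which lies in the isomorphism locus `U_σ` of `σ`).
[cite: Temkin2013, §1 p. 3 (i) ⊂ (iii) (a resolution is a purely inseparable alteration);
composition bookkeeping posed here as an obligation] -/
@[conjecture] def SoloBlind.ResolveStep : Prop :=
  ∀ (X Z Z' : Scheme.{u}) (ρ : Z ⟶ X) (σ : Z' ⟶ Z) (q : ℕ), IsIntegral X → IsIntegral Z →
    IsPurelyInseparableAlterationOfExponent q ρ → IsResolution σ →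
      IsIntegral Z' ∧ IsPurelyInseparableAlterationOfExponent q (σ ≫ ρ)

/-- LEMMA NODE **B** (base of the tower; not yet formalised). A purely inseparable alteration
`π : Y → X` of exponent `1` between integral schemes with `Y` regular is a resolution of `X`:
over the dense open `U`, `π` is finite with all `π^*` surjective, i.e. a surjective closed
immersion onto the reduced scheme `U`, hence an isomorphism; `π⁻¹ U` is a non-empty open of the
integral `Y`, hence dense. [cite: Temkin2013, §1 p. 3 (i) (actual desingularisation: m = 1,
K₁ = K); posed here as an obligation] -/
@[conjecture] def SoloBlind.BaseStep : Prop :=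
  ∀ (X Y : Scheme.{u}) (π : Y ⟶ X), IsIntegral X → IsIntegral Y → Scheme.IsRegular Y →
    IsPurelyInseparableAlterationOfExponent 1 π → Scheme.HasResolution X

/-- LEMMA NODE **C** (irreducible components; not yet formalised). Over a field `k`, resolution
of INTEGRAL separated `k`-schemes of finite type implies resolution of REDUCED ones: resolve each
irreducible component (with its reduced structure) and take the disjoint union, which is proper
over `X` and an isomorphism over the dense open of points lying on exactly one component and in
the isomorphism locus of that component's resolution. [cite: EGAIV2, §7.9 (7.9.1–7.9.3:
morphisme résolvant, reduction to the irreducible components); posed here as an obligation] -/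
@[conjecture] def SoloBlind.ComponentStep : Prop :=
  ∀ (k : Type u) [Field k],
    (∀ (X : Scheme.{u}) (g : X ⟶ Spec (.of k)), IsSeparated g → LocallyOfFiniteType g →
        QuasiCompact g → IsIntegral X → Scheme.HasResolution X) →
      ∀ (X : Scheme.{u}) (g : X ⟶ Spec (.of k)), IsSeparated g → LocallyOfFiniteType g →
        QuasiCompact g → IsReduced X → Scheme.HasResolution X

/-! ## Theorem A: the tower induction -/

/-- **Descent of regularity down a purely inseparable tower, one Frobenius layer at a time.**
Under the lemma nodes Q, R, B and the crux F1: if an integral separated `k`-scheme of finite type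
`X` (`char k = p` prime) receives a purely inseparable alteration of exponent `p ^ e` from a
regular integral `Y`, then `X` admits a resolution of singularities. Induction on `e`. -/
theorem SoloBlind.hasResolution_of_alterationOfExponent (hQ : SoloBlind.QuotientStep.{u})
    (hR : SoloBlind.ResolveStep.{u}) (hB : SoloBlind.BaseStep.{u})
    (hF : SoloBlind.FrobeniusSandwichResolution.{u}) {p : ℕ} (hp : p.Prime) (k : Type u)
    [Field k] [CharP k p] :
    ∀ (e : ℕ) (X Y : Scheme.{u}) (g : X ⟶ Spec (.of k)) (π : Y ⟶ X),
      IsSeparated g → LocallyOfFiniteType g → QuasiCompact g → IsIntegral X → IsIntegral Y →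
        Scheme.IsRegular Y → IsPurelyInseparableAlterationOfExponent (p ^ e) π →
          Scheme.HasResolution X := by
  intro e
  induction e with
  | zero =>
    intro X Y g π _ _ _ hX hY hYreg hπ
    exact hB X Y π hX hY hYreg (by simpa using hπ)
  | succ e ih =>
    intro X Y g π hs hl hq hX hY hYreg hπ
    obtain ⟨Z, f, ρ, -, hZs, hZl, hZq, hZ, hfin, hsurj, hrad, hρ⟩ :=
      hQ p k X Y g π e hp hs hl hq hX hY hYreg hπ
    -- `Z` is a Frobenius sandwich under the regular `Y`; resolve it by the crux F1
    have hsand : IsFrobeniusSandwich p Z := ⟨Y, f, hY, hYreg, hfin, hsurj, hrad⟩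
    obtain ⟨Z', σ, hσ⟩ := hF p k Z (ρ ≫ g) hp hZs hZl hZq hZ hsand
    -- compose: `Z' → Z → X` is a purely inseparable alteration of exponent `p ^ e`, regular source
    obtain ⟨hZ', hσρ⟩ := hR X Z Z' ρ σ (p ^ e) hX hZ hρ hσ
    exact ih X Z' g (σ ≫ ρ) hs hl hq hX hZ' hσ.isRegular hσρ

/-- **Theorem A, characteristic by characteristic.** Under the lemma nodes E, Q, R, B, C: the
Abramovich–Oort conjecture together with resolution of Frobenius sandwiches implies resolution of
singularities in every prime characteristic `p` (reduced separated schemes of finite type over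
any field of characteristic `p`). -/
theorem SoloBlind.resolutionInChar_of_abramovichOort_of_sandwich
    (hAO : AbramovichOortConjecture.{u}) (hF : SoloBlind.FrobeniusSandwichResolution.{u})
    (hE : SoloBlind.ExponentStep.{u}) (hQ : SoloBlind.QuotientStep.{u})
    (hR : SoloBlind.ResolveStep.{u}) (hB : SoloBlind.BaseStep.{u})
    (hC : SoloBlind.ComponentStep.{u}) {p : ℕ} (hp : p.Prime) : ResolutionInChar.{u} p := by
  intro k _ _ X f hs hl hq hred
  refine hC k (fun X g hs hl hq hX => ?_) X f hs hl hq hred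
  obtain ⟨Y, π, hπ, hYreg⟩ := hAO k X g hs hl hq hX
  obtain ⟨e, he⟩ := hE p k X Y g π hp hs hl hq hX hπ
  exact SoloBlind.hasResolution_of_alterationOfExponent hQ hR hB hF hp k e X Y g π hs hl hq hX
    hπ.isIntegral hYreg he

/-! ## Theorem A for the summit, as a registered statement with its proof -/

/-- **Theorem A (Frobenius-sandwich reduction of the summit)** — a PROVED implication
(`SoloBlind.SandwichReduction_holds` below), recorded as a named statement: the Abramovich–Oort
conjecture (regular purely inseparable alterations), resolution of Frobenius sandwiches, and the
five elementary lemma nodes E, Q, R, B, C together imply `ResolutionOfSingularities`.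
[cite: AbramovichOort2000, Question 2.13, p. 9 ("weak resolution up to purely inseparable
alterations?" — the statement here identifies what must be added to it)] -/
@[conjecture] def SoloBlind.SandwichReduction : Prop :=
  AbramovichOortConjecture.{0} → SoloBlind.FrobeniusSandwichResolution.{0} →
    SoloBlind.ExponentStep.{0} → SoloBlind.QuotientStep.{0} → SoloBlind.ResolveStep.{0} →
      SoloBlind.BaseStep.{0} → SoloBlind.ComponentStep.{0} → _root_.ResolutionOfSingularities

/-- Proof of Theorem A for the summit statement `ResolutionOfSingularities`
(`= ∀ p, p.Prime → ResolutionInChar.{0} p`). -/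
theorem SoloBlind.SandwichReduction_holds : SoloBlind.SandwichReduction :=
  fun hAO hF hE hQ hR hB hC _ hp =>
    SoloBlind.resolutionInChar_of_abramovichOort_of_sandwich hAO hF hE hQ hR hB hC hp

/-! ## Converse bookkeeping: the crux is implied by the summit -/

/-- Resolution in every prime characteristic implies resolution of Frobenius sandwiches (a
Frobenius sandwich of finite type over a field is in particular an integral, hence reduced,
separated scheme of finite type). Together with `abramovichOort_of_resolutionInChar` (in tree)
this shows that both hypotheses (AO), (F1) of Theorem A are consequences of the summit, prime by
prime. Recorded as a named statement with its proof. [folklore] -/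
@[conjecture] def SoloBlind.SandwichConverse : Prop :=
  (∀ p : ℕ, p.Prime → ResolutionInChar.{u} p) → SoloBlind.FrobeniusSandwichResolution.{u}

/-- Proof of `SoloBlind.SandwichConverse`. -/
theorem SoloBlind.SandwichConverse_holds : SoloBlind.SandwichConverse.{u} := by
  intro h p k _ _ Z g hp hs hl hq hZ _
  haveI := hZ
  exact h p hp k Z g hs hl hq inferInstance

end Summit.ResolutionOfSingularities.ResolutionOfSingularities.Theorems

end
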